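import Literature.NumberTheory.LFunctions.TrigPolyLocallyConstant
import Literature.NumberTheory.LFunctions.SeparatedPointSums
import HarnessLib

/-!
# Small GCD terms: the discrete third moment of `R` (Guth–Maynard Lemma 11.8)

Topic `NumberTheory/LFunctions`, family RH. Part of the programme around the tree's named fact
`Literature.NumberTheory.LFunctions.zeroDensity_guth_maynard`, reduced by `LargeValuesAssembly.lean` to
Propositions 6.1, 10.1, 11.1 of L. Guth, J. Maynard, *New large value estimates for Dirichlet
polynomials*, Ann. of Math. 203 (2026). With `EnergyThirdMoment.lean` (Lemmas 11.3–11.4),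
`TrigPolyLocallyConstant.lean` (Lemma 11.7) and `SeparatedPointSums.lean`, this file PROVES
**Lemma 11.8 ("Small GCD terms")** of the proof of Proposition 11.1 — the last ingredient of §11
that does not depend on Heath-Brown's theorem:

* `gcdPairs N d` — the pairs `(n₁,n₂) ∈ [N,2N]²` with `gcd(n₁,n₂) = d`; `tauPt p = −log(p₁/p₂)/2π`, so
  that `R(p₁/p₂) = Ŵ(tauPt p)` (`Rfun_eq_trigPoly_tauPt`); reduced fractions are unique
  (`gcdPairs_inj`) and the points `tauPt` are `d²/(16πN²)`-separated (`tauPt_sep`, from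
  `SeparatedSums.abs_log_div_sub_ge`: "the fractions `n₁'/n₂'` are `d²/N²`-separated");
* `gcdPairs_third_moment_le` — for `W ⊂ [T₀, T₀+T]`:
  `∑_{gcd=d} |R(n₁/n₂)|³ ≤ C (T + N²/d²) ∫_{[−1,1]} |Ŵ(τ)|³ dτ + C N²|W|³/T³`, by the cubic form of
  Lemma 11.7 (`GuthMaynardLocallyConstant.norm_trigPoly_cube_le_integral`), the substitution
  `ξ = T(τ_p − τ')`, the kernel count `∑_x |ψ̂(T(x−τ'))| ≪ 1 + N²/(d²T)`
  (`SeparatedSums.sum_norm_fourier_le`) on `|τ'| ≤ 1` and the decay `|ψ̂(u)| ≪ u^{-4}` on `|τ'| > 1`;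
* `small_gcd_third_moment` — **Lemma 11.8**: for finite `1`-separated `W ⊂ [T₀,T₀+T]`, `N, D ≥ 1`,
  `T, Dl ≥ 1` and every `j`,
  `∑_{d≤D} ∑_{gcd=d} |R(n₁/n₂)|³ ≤ C(DT + N²)|W|^{1/2}(Dl·E(W) + Dl^{1−j}|W|⁴)^{1/2} + C D N²|W|³/T³`
  (`∑_d (T + N²/d²) ≤ DT + 2N²`, Cauchy–Schwarz on `[−1,1]`, `SeparatedSums.L2_bound_sharp` and
  `GuthMaynardRFunction.L4_bound` for a bump equal to `1` on `[−1,1]`); with `D = N²/T`, `Dl = T^η`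
  this is the paper's (11.23), `∑_{gcd≤D}|R|³ ⪅ N²|W|^{1/2}E(W)^{1/2}`. Here `E(W)` is the additive
  energy count `#{|t₁+t₂−t₃−t₄| ≤ 1}` (the expression of `GuthMaynardAssembly.addEnergy`).

What remains of Proposition 11.1 ("Bound for energy") after this file: Lemmas 11.5, 11.6, 11.9 —
all consequences of Heath-Brown's theorem [Heath-Brown 1979] — and the final algebra of §11.
Definitions (with bodies): `gcdPairs`, `tauPt`. No named fact is introduced; everything is proved.

## References

* L. Guth, J. Maynard, *New large value estimates for Dirichlet polynomials*, Ann. of Math. (2)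
  203 (2026), no. 2; arXiv:2405.20552 (2024): §11, Lemma 11.8, its proof, and eqs. (11.22)–(11.23).
-/

noncomputable section

open Real Set Filter Topology Complex MeasureTheory Finset
open scoped FourierTransform ContDiff

namespace Literature.NumberTheory.LFunctions

namespace GuthMaynardSmallGCD

open GuthMaynardFourier GuthMaynardRFunction GuthMaynardEnergy GuthMaynardLocallyConstant SeparatedSums

/-! ## §1. Pairs with a given gcd, their fractions and the points `τ = −log(n₁/n₂)/2π` -/

/-- The pairs `(n₁, n₂) ∈ [N, 2N]²` with `gcd(n₁, n₂) = d`. [cite: GuthMaynard2026, (11.22)] -/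
def gcdPairs (N d : ℕ) : Finset (ℕ × ℕ) :=
  ((Finset.Icc N (2 * N)) ×ˢ (Finset.Icc N (2 * N))).filter fun p ↦ Nat.gcd p.1 p.2 = d

/-- The point `τ(p) = −log(p₁/p₂)/(2π)` with `R(p₁/p₂) = Ŵ(τ(p))`. [cite: GuthMaynard2026, Lemma 11.7] -/
def tauPt (p : ℕ × ℕ) : ℝ := -Real.log ((p.1 : ℝ) / p.2) / (2 * π)

/-- Membership in `gcdPairs`. [folklore] -/
theorem mem_gcdPairs {N d : ℕ} {p : ℕ × ℕ} :
    p ∈ gcdPairs N d ↔ (N ≤ p.1 ∧ p.1 ≤ 2 * N) ∧ (N ≤ p.2 ∧ p.2 ≤ 2 * N) ∧ Nat.gcd p.1 p.2 = d := by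
  simp only [gcdPairs, Finset.mem_filter, Finset.mem_product, Finset.mem_Icc, and_assoc]

/-- Basic facts about a pair with `gcd = d` (`N ≥ 1`): `d ≥ 1`, the reduced pair `(p₁/d, p₂/d)` is
coprime with `1 ≤ p₂/d ≤ 2N/d`, and `p₁/p₂ = (p₁/d)/(p₂/d) ∈ [1/2, 2]`. [folklore] -/
theorem gcdPairs_facts {N d : ℕ} (hN : 1 ≤ N) {p : ℕ × ℕ} (hp : p ∈ gcdPairs N d) :
    1 ≤ d ∧ 1 ≤ p.1 / d ∧ 1 ≤ p.2 / d ∧ Nat.Coprime (p.1 / d) (p.2 / d) ∧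
      ((p.2 / d : ℕ) : ℝ) ≤ 2 * N / d ∧
      ((p.1 : ℝ) / p.2 = ((p.1 / d : ℕ) : ℝ) / ((p.2 / d : ℕ) : ℝ)) ∧
      (1 / 2 ≤ (p.1 : ℝ) / p.2 ∧ (p.1 : ℝ) / p.2 ≤ 2) := by
  rw [mem_gcdPairs] at hp
  obtain ⟨⟨h11, h12⟩, ⟨h21, h22⟩, hg⟩ := hp
  have hp1 : 1 ≤ p.1 := le_trans hN h11
  have hp2 : 1 ≤ p.2 := le_trans hN h21
  have hd1 : 1 ≤ d := by
    rw [← hg]; exact Nat.pos_of_ne_zero (Nat.gcd_ne_zero_left (by omega))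
  have hd1' : (0 : ℝ) < d := by exact_mod_cast hd1
  have hdv1 : d ∣ p.1 := hg ▸ Nat.gcd_dvd_left _ _
  have hdv2 : d ∣ p.2 := hg ▸ Nat.gcd_dvd_right _ _
  obtain ⟨a, ha⟩ := hdv1
  obtain ⟨b, hb⟩ := hdv2
  have hda : p.1 / d = a := by rw [ha, Nat.mul_div_cancel_left _ hd1]
  have hdb : p.2 / d = b := by rw [hb, Nat.mul_div_cancel_left _ hd1]
  have ha1 : 1 ≤ a := by
    by_contra h; push Not at h; interval_cases a; simp at ha; omega
  have hb1 : 1 ≤ b := by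
    by_contra h; push Not at h; interval_cases b; simp at hb; omega
  have hcop : Nat.Coprime a b := by
    have := Nat.coprime_div_gcd_div_gcd (m := p.1) (n := p.2) (by rw [hg]; exact hd1)
    rwa [hg, hda, hdb] at this
  have hp10 : (0 : ℝ) < p.1 := by exact_mod_cast hp1
  have hp20 : (0 : ℝ) < p.2 := by exact_mod_cast hp2
  refine ⟨hd1, hda ▸ ha1, hdb ▸ hb1, by rwa [hda, hdb], ?_, ?_, ?_, ?_⟩
  · rw [hdb, le_div_iff₀ hd1']
    have : ((b : ℕ) : ℝ) * d = p.2 := by rw [hb]; push_cast; ring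
    rw [this]; exact_mod_cast h22
  · rw [hda, hdb, ha, hb]; push_cast
    have ha0 : (0 : ℝ) < a := by exact_mod_cast ha1
    have hb0 : (0 : ℝ) < b := by exact_mod_cast hb1
    field_simp
  · rw [le_div_iff₀ hp20]
    have : (p.2 : ℝ) ≤ 2 * N := by exact_mod_cast h22
    have : (N : ℝ) ≤ p.1 := by exact_mod_cast h11
    linarith
  · rw [div_le_iff₀ hp20]
    have : (p.1 : ℝ) ≤ 2 * N := by exact_mod_cast h12
    have : (N : ℝ) ≤ p.2 := by exact_mod_cast h21
    linarith

/-- **Reduced fractions are unique**: two pairs in `gcdPairs N d` with the same value of `p₁/p₂`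
coincide. [folklore] -/
theorem gcdPairs_inj {N d : ℕ} (hN : 1 ≤ N) {p p' : ℕ × ℕ} (hp : p ∈ gcdPairs N d)
    (hp' : p' ∈ gcdPairs N d) (h : (p.1 : ℝ) / p.2 = (p'.1 : ℝ) / p'.2) : p = p' := by
  obtain ⟨hd1, ha1, hb1, hcop, -, hx, -⟩ := gcdPairs_facts hN hp
  obtain ⟨-, ha1', hb1', hcop', -, hx', -⟩ := gcdPairs_facts hN hp'
  rw [hx, hx'] at h
  set a := p.1 / d with ha
  set b := p.2 / d with hb
  set a' := p'.1 / d with ha'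
  set b' := p'.2 / d with hb'
  have hb0 : (0 : ℝ) < b := by exact_mod_cast hb1
  have hb0' : (0 : ℝ) < b' := by exact_mod_cast hb1'
  have hcross : a * b' = a' * b := by
    rw [div_eq_div_iff hb0.ne' hb0'.ne'] at h
    exact_mod_cast h
  have h1 : a ∣ a' := hcop.dvd_of_dvd_mul_right (Dvd.intro b' (by rw [hcross]))
  have h2 : a' ∣ a := hcop'.dvd_of_dvd_mul_right (Dvd.intro b (by rw [← hcross]))
  have haa : a = a' := Nat.dvd_antisymm h1 h2
  have hbb : b = b' := by
    rw [haa] at hcross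
    exact (Nat.eq_of_mul_eq_mul_left (by omega) hcross).symm
  have hg := (mem_gcdPairs.mp hp).2.2
  have hg' := (mem_gcdPairs.mp hp').2.2
  have hdv1 : d ∣ p.1 := hg ▸ Nat.gcd_dvd_left _ _
  have hdv2 : d ∣ p.2 := hg ▸ Nat.gcd_dvd_right _ _
  have hdv1' : d ∣ p'.1 := hg' ▸ Nat.gcd_dvd_left _ _
  have hdv2' : d ∣ p'.2 := hg' ▸ Nat.gcd_dvd_right _ _
  ext
  · calc p.1 = d * (p.1 / d) := (Nat.mul_div_cancel' hdv1).symm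
      _ = d * (p'.1 / d) := by rw [← ha, haa]
      _ = p'.1 := Nat.mul_div_cancel' hdv1'
  · calc p.2 = d * (p.2 / d) := (Nat.mul_div_cancel' hdv2).symm
      _ = d * (p'.2 / d) := by rw [← hb, hbb]
      _ = p'.2 := Nat.mul_div_cancel' hdv2'

/-- **The points `τ(p)` of `gcdPairs N d` are `d²/(16πN²)`-separated.** [cite: GuthMaynard2026, proof of Lemma 11.8] -/
theorem tauPt_sep {N d : ℕ} (hN : 1 ≤ N) {p p' : ℕ × ℕ} (hp : p ∈ gcdPairs N d)
    (hp' : p' ∈ gcdPairs N d) (hne : p ≠ p') :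
    (d : ℝ) ^ 2 / (16 * π * (N : ℝ) ^ 2) ≤ |tauPt p - tauPt p'| := by
  obtain ⟨hd1, ha1, hb1, hcop, hbB, hx, h12, h2⟩ := gcdPairs_facts hN hp
  obtain ⟨-, ha1', hb1', hcop', hbB', hx', h12', h2'⟩ := gcdPairs_facts hN hp'
  have hxne : (p.1 : ℝ) / p.2 ≠ (p'.1 : ℝ) / p'.2 := fun h ↦ hne (gcdPairs_inj hN hp hp' h)
  have hN0 : (0 : ℝ) < N := by exact_mod_cast hN
  have hd0 : (0 : ℝ) < d := by exact_mod_cast hd1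
  set B : ℝ := 2 * N / d with hB
  have hxne' : ((p.1 / d : ℕ) : ℝ) / ((p.2 / d : ℕ) : ℝ) ≠ ((p'.1 / d : ℕ) : ℝ) / ((p'.2 / d : ℕ) : ℝ) := by
    rwa [← hx, ← hx']
  have hL := abs_log_div_sub_ge (B := B) hb1 hb1' hbB hbB' hxne' (hx ▸ h12) (hx ▸ h2) (hx' ▸ h12')
    (hx' ▸ h2')
  rw [← hx, ← hx'] at hL
  have hτ : tauPt p - tauPt p' = -(Real.log ((p.1 : ℝ) / p.2) - Real.log ((p'.1 : ℝ) / p'.2)) / (2 * π) := by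
    simp only [tauPt]; ring
  rw [hτ, abs_div, abs_neg, abs_of_pos (by positivity : (0 : ℝ) < 2 * π), le_div_iff₀ (by positivity)]
  calc (d : ℝ) ^ 2 / (16 * π * (N : ℝ) ^ 2) * (2 * π) = 1 / (2 * B ^ 2) := by
        rw [hB]; field_simp; ring
    _ ≤ _ := hL

/-- `|τ(p)| ≤ log 2/(2π) ≤ 1/4` on `gcdPairs`. [folklore] -/
theorem abs_tauPt_le {N d : ℕ} (hN : 1 ≤ N) {p : ℕ × ℕ} (hp : p ∈ gcdPairs N d) :
    |tauPt p| ≤ 1 / 4 := by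
  obtain ⟨-, -, -, -, -, -, h12, h2⟩ := gcdPairs_facts hN hp
  have hx0 : (0 : ℝ) < (p.1 : ℝ) / p.2 := by linarith
  have hlog : |Real.log ((p.1 : ℝ) / p.2)| ≤ Real.log 2 := by
    rw [abs_le]
    constructor
    · have := Real.log_le_log (by norm_num) h12
      rw [Real.log_div (by norm_num) (by norm_num), Real.log_one, zero_sub] at this
      exact this
    · exact Real.log_le_log hx0 h2
  have hl2 : Real.log 2 ≤ 1 := by
    have := Real.log_le_sub_one_of_pos two_pos; linarith
  rw [tauPt, abs_div, abs_neg, abs_of_pos (by positivity : (0 : ℝ) < 2 * π), div_le_iff₀ (by positivity)]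
  nlinarith [Real.two_le_pi]

/-- `R(p₁/p₂) = Ŵ(τ(p))`. [cite: GuthMaynard2026, (7.2)] -/
theorem Rfun_eq_trigPoly_tauPt (W : Finset ℝ) {N d : ℕ} (hN : 1 ≤ N) {p : ℕ × ℕ}
    (hp : p ∈ gcdPairs N d) : Rfun W ((p.1 : ℝ) / p.2) = trigPoly W (tauPt p) := by
  obtain ⟨-, -, -, -, -, -, h12, -⟩ := gcdPairs_facts hN hp
  rw [Rfun_eq_trigPoly, tauPt, abs_of_pos (by linarith)]

/-- `#gcdPairs N d ≤ (N+1)²`. [folklore] -/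
theorem card_gcdPairs_le (N d : ℕ) : ((gcdPairs N d).card : ℝ) ≤ ((N : ℝ) + 1) ^ 2 := by
  have h1 : (gcdPairs N d).card ≤ ((Finset.Icc N (2 * N)) ×ˢ (Finset.Icc N (2 * N))).card :=
    Finset.card_filter_le _ _
  rw [Finset.card_product, Nat.card_Icc, show 2 * N + 1 - N = N + 1 by omega] at h1
  have : ((gcdPairs N d).card : ℝ) ≤ ((N + 1) * (N + 1) : ℕ) := by exact_mod_cast h1
  push_cast at this
  nlinarith

/-! ## §2. The per-`d` bound: cubic Lemma 11.7 summed over the fractions with `gcd = d` -/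

/-- Substitution `ξ = T(c − τ)`: `∫ f(ξ) g(c − ξ/T) dξ = T ∫ f(T(c−τ)) g(τ) dτ` (`T > 0`). [folklore] -/
theorem integral_comp_scale (f g : ℝ → ℝ) {T : ℝ} (hT : 0 < T) (c : ℝ) :
    ∫ ξ, f ξ * g (c - ξ / T) = T * ∫ τ, f (T * (c - τ)) * g τ := by
  set H : ℝ → ℝ := fun y ↦ f (T * (c - y)) * g y with hH
  have h1 : (fun ξ ↦ f ξ * g (c - ξ / T)) = fun ξ ↦ (fun y ↦ H (c + y)) ((-T⁻¹) * ξ) := by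
    ext ξ
    simp only [hH]
    have : T * (c - (c + -T⁻¹ * ξ)) = ξ := by field_simp; ring
    rw [this, show c + -T⁻¹ * ξ = c - ξ / T by ring]
  rw [h1, Measure.integral_comp_mul_left (fun y ↦ H (c + y)) (-T⁻¹)]
  rw [inv_neg, inv_inv, abs_neg, abs_of_pos hT, smul_eq_mul]
  congr 1
  exact integral_add_left_eq_self H c

/-- The tail weight `m(τ) = 0 (|τ| ≤ 1), 1/τ² (|τ| > 1)` is integrable with `∫ m ≤ 2`. [folklore] -/
theorem tail_weight_integral :
    Integrable (fun τ : ℝ ↦ if |τ| ≤ 1 then (0 : ℝ) else 1 / τ ^ 2) ∧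
      ∫ τ : ℝ, (if |τ| ≤ 1 then (0 : ℝ) else 1 / τ ^ 2) ≤ 2 := by
  have hmeas : Measurable (fun τ : ℝ ↦ if |τ| ≤ 1 then (0 : ℝ) else 1 / τ ^ 2) := by
    refine Measurable.ite (measurableSet_le (by fun_prop) measurable_const) measurable_const ?_
    fun_prop
  have hint : Integrable (fun τ : ℝ ↦ if |τ| ≤ 1 then (0 : ℝ) else 1 / τ ^ 2) := by
    refine (integrable_majorant 1).mono' hmeas.aestronglyMeasurable (Eventually.of_forall fun τ ↦ ?_)
    rw [Real.norm_eq_abs]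
    by_cases h1 : |τ| ≤ 1
    · rw [if_pos h1, abs_zero]; split_ifs <;> positivity
    · rw [if_neg h1, abs_of_nonneg (by positivity)]
      push Not at h1
      have hτ : 1 < τ ^ 2 := by rw [← sq_abs]; nlinarith
      split_ifs with h2
      · rw [div_le_one (by positivity)]; linarith
      · gcongr; norm_num
  refine ⟨hint, ?_⟩
  -- `∫ m = 2 ∫_{Ioi 0} m = 2 ∫_{Ioi 1} τ⁻² = 2`
  have hca := integral_comp_abs (f := fun y : ℝ ↦ if y ≤ 1 then (0 : ℝ) else 1 / y ^ 2)
  simp only [sq_abs] at hca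
  rw [hca]
  have h2 : ∫ y in Set.Ioi (0 : ℝ), (if y ≤ 1 then (0 : ℝ) else 1 / y ^ 2) =
      ∫ y in Set.Ioi (1 : ℝ), y ^ (-2 : ℝ) := by
    have : (fun y : ℝ ↦ if y ≤ 1 then (0 : ℝ) else 1 / y ^ 2) =
        (Set.Ioi (1 : ℝ)).indicator (fun y ↦ y ^ (-2 : ℝ)) := by
      ext y
      by_cases hy : y ≤ 1
      · rw [if_pos hy, Set.indicator_of_notMem (by simpa using hy)]
      · rw [if_neg hy, Set.indicator_of_mem (by simpa using hy)]
        push Not at hy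
        rw [Real.rpow_neg (by linarith), show (2 : ℝ) = (2 : ℕ) by norm_num, Real.rpow_natCast,
          one_div]
    rw [this, setIntegral_indicator measurableSet_Ioi,
      Set.inter_eq_right.mpr (Set.Ioi_subset_Ioi zero_le_one)]
  rw [h2, integral_Ioi_rpow_of_lt (by norm_num) one_pos]
  norm_num

section bump

variable {ψ : ℝ → ℝ}

set_option maxHeartbeats 1000000 in
/-- **The per-`d` third-moment bound (core of Lemma 11.8).** Let `ψ` be a smooth compactly supported
bump with `ψ = 1` on `[0,1]`. There is `C = C(ψ)` such that for all `N, d ≥ 1`, `T ≥ 1`, `T₀` and finite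
`W ⊂ [T₀, T₀ + T]`,
`∑_{(n₁,n₂)∈[N,2N]², gcd=d} |R(n₁/n₂)|³ ≤ C (T + N²/d²) ∫_{[−1,1]} |Ŵ(τ)|³ dτ + C N² |W|³ / T³`:
the cubic form of Lemma 11.7 at the `d²/(16πN²)`-separated points `τ = −log(n₁/n₂)/2π`
(`tauPt_sep`), the kernel count `∑_x |ψ̂(T(x − τ'))| ≪ 1 + N²/(d²T)` (`SeparatedSums.sum_norm_fourier_le`),
and the tail `|τ'| > 1` via the decay `|ψ̂(u)| ≪ u^{-4}`.
[cite: GuthMaynard2026, proof of Lemma 11.8] -/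
theorem gcdPairs_third_moment_le (hψ : ContDiff ℝ ∞ ψ) (hψs : HasCompactSupport ψ)
    (hψ1 : ∀ x : ℝ, 0 ≤ x → x ≤ 1 → ψ x = 1) :
    ∃ C, 0 ≤ C ∧ ∀ (N d : ℕ), 1 ≤ N → 1 ≤ d → ∀ (T T₀ : ℝ), 1 ≤ T → ∀ (W : Finset ℝ),
      (∀ t ∈ W, T₀ ≤ t ∧ t ≤ T₀ + T) →
      ∑ p ∈ gcdPairs N d, ‖Rfun W ((p.1 : ℝ) / p.2)‖ ^ 3 ≤
        C * (T + (N : ℝ) ^ 2 / (d : ℝ) ^ 2) * (∫ τ in Set.Icc (-1 : ℝ) 1, ‖trigPoly W τ‖ ^ 3) +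
        C * (N : ℝ) ^ 2 * (W.card : ℝ) ^ 3 / T ^ 3 := by
  -- the constants
  set F : ℝ → ℂ := 𝓕 (fun y ↦ (ψ y : ℂ)) with hF
  have hFi : Integrable F := integrable_fourier_bump hψ hψs
  have hc : ContDiff ℝ ∞ (fun y ↦ (ψ y : ℂ)) := Complex.ofRealCLM.contDiff.comp hψ
  have hs : HasCompactSupport (fun y ↦ (ψ y : ℂ)) := hψs.comp_left Complex.ofReal_zero
  obtain ⟨K, hK0, hK⟩ := sum_norm_fourier_le hc hs
  obtain ⟨K₄, hK₄0, -, hK₄d⟩ := fourier_decay hc hs 4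
  set A : ℝ := max 1 (∫ ξ, ‖F ξ‖) with hA
  have hA0 : 0 ≤ A := le_trans zero_le_one (le_max_left _ _)
  obtain ⟨hmi, hm2⟩ := tail_weight_integral
  set C : ℝ := max (16 * A ^ 2 * K * (16 * π)) (256 * A ^ 2 * K₄) with hC
  have hC0 : 0 ≤ C := le_max_of_le_left (by positivity)
  refine ⟨C, hC0, fun N d hN hd T T₀ hT W hW ↦ ?_⟩
  classical
  have hN0 : (0 : ℝ) < N := by exact_mod_cast hN
  have hd0 : (0 : ℝ) < d := by exact_mod_cast hd
  have hT0 : 0 < T := by linarith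
  set P := gcdPairs N d with hP
  set δ : ℝ := (d : ℝ) ^ 2 / (16 * π * (N : ℝ) ^ 2) with hδ
  have hδ0 : 0 < δ := by positivity
  -- `Ŵ` is bounded and continuous
  have hWle : ∀ τ' : ℝ, ‖trigPoly W τ'‖ ≤ W.card := norm_trigPoly_le W
  have hWcont : Continuous (trigPoly W) := by
    unfold trigPoly; refine continuous_finsetSum _ fun t _ ↦ ?_; fun_prop
  -- Step 1: the cubic bound at each point, after the substitution
  have hstep1 : ∀ p ∈ P, ‖Rfun W ((p.1 : ℝ) / p.2)‖ ^ 3 ≤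
      2 * A ^ 2 * (T * ∫ τ', ‖F (T * (tauPt p - τ'))‖ * ‖trigPoly W τ'‖ ^ 3) := by
    intro p hp
    rw [Rfun_eq_trigPoly_tauPt W hN hp]
    refine (norm_trigPoly_cube_le_integral hψ hψs hψ1 hT0 W hW (tauPt p)).trans (le_of_eq ?_)
    rw [← integral_comp_scale (fun ξ ↦ ‖F ξ‖) (fun τ ↦ ‖trigPoly W τ‖ ^ 3) hT0 (tauPt p)]
  -- integrability of the summands
  have hIp : ∀ p : ℕ × ℕ, Integrable (fun τ' ↦ ‖F (T * (tauPt p - τ'))‖ * ‖trigPoly W τ'‖ ^ 3) := by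
    intro p
    have h1 : Integrable (fun τ' : ℝ ↦ ‖F (T * (tauPt p - τ'))‖) := by
      have := ((hFi.norm.comp_mul_left' (neg_ne_zero.mpr hT0.ne')).comp_sub_right (tauPt p))
      refine this.congr (Eventually.of_forall fun τ' ↦ ?_)
      ring_nf
    exact h1.mul_bdd (c := (W.card : ℝ) ^ 3) ((hWcont.norm.pow 3).aestronglyMeasurable)
      (Eventually.of_forall fun τ' ↦ by
        rw [Real.norm_eq_abs, abs_of_nonneg (pow_nonneg (norm_nonneg _) 3)]
        exact pow_le_pow_left₀ (norm_nonneg _) (hWle _) 3)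
  -- Step 2: sum over `p`
  have hstep2 : ∑ p ∈ P, ‖Rfun W ((p.1 : ℝ) / p.2)‖ ^ 3 ≤
      2 * A ^ 2 * T * ∫ τ', (∑ p ∈ P, ‖F (T * (tauPt p - τ'))‖) * ‖trigPoly W τ'‖ ^ 3 := by
    calc ∑ p ∈ P, ‖Rfun W ((p.1 : ℝ) / p.2)‖ ^ 3
        ≤ ∑ p ∈ P, 2 * A ^ 2 * (T * ∫ τ', ‖F (T * (tauPt p - τ'))‖ * ‖trigPoly W τ'‖ ^ 3) :=
          Finset.sum_le_sum hstep1
      _ = 2 * A ^ 2 * T * ∑ p ∈ P, ∫ τ', ‖F (T * (tauPt p - τ'))‖ * ‖trigPoly W τ'‖ ^ 3 := by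
          rw [Finset.mul_sum]; refine Finset.sum_congr rfl fun p _ ↦ by ring
      _ = 2 * A ^ 2 * T * ∫ τ', ∑ p ∈ P, ‖F (T * (tauPt p - τ'))‖ * ‖trigPoly W τ'‖ ^ 3 := by
          rw [integral_finsetSum _ (fun p _ ↦ hIp p)]
      _ = _ := by
          congr 1
          refine integral_congr_ae (Eventually.of_forall fun τ' ↦ ?_)
          simp only [Finset.sum_mul]
  -- Step 3 (i): the kernel sum over the separated points
  have hinj : Set.InjOn tauPt (P : Set (ℕ × ℕ)) := by
    intro p hp p' hp' h
    by_contra hne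
    have := tauPt_sep hN hp hp' hne
    rw [h, sub_self, abs_zero] at this
    linarith
  have hsepX : ∀ x ∈ P.image tauPt, ∀ x' ∈ P.image tauPt, x ≠ x' → δ ≤ |x - x'| := by
    intro x hx x' hx' hne
    rw [Finset.mem_image] at hx hx'
    obtain ⟨p, hp, rfl⟩ := hx
    obtain ⟨p', hp', rfl⟩ := hx'
    exact tauPt_sep hN hp hp' (fun h ↦ hne (by rw [h]))
  have hS1 : ∀ τ' : ℝ, ∑ p ∈ P, ‖F (T * (tauPt p - τ'))‖ ≤ 8 * K * (1 + 1 / (T * δ)) := by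
    intro τ'
    rw [← Finset.sum_image (g := tauPt) (f := fun x ↦ ‖F (T * (x - τ'))‖) hinj]
    exact hK T δ hT0 hδ0 (P.image tauPt) hsepX τ' (fun x ↦ T * (x - τ')) fun x _ ↦ by
      rw [abs_mul, abs_of_pos hT0]
  -- Step 3 (ii): the tail
  have hS2 : ∀ τ' : ℝ, 1 < |τ'| → ∑ p ∈ P, ‖F (T * (tauPt p - τ'))‖ ≤
      ((N : ℝ) + 1) ^ 2 * (16 * K₄ / T ^ 4) * (1 / τ' ^ 2) := by
    intro τ' hτ'
    have hbound : ∀ p ∈ P, ‖F (T * (tauPt p - τ'))‖ ≤ 16 * K₄ / T ^ 4 * (1 / τ' ^ 2) := by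
      intro p hp
      have h14 := abs_tauPt_le hN hp
      have hdist : |τ'| / 2 ≤ |tauPt p - τ'| := by
        have := abs_sub_abs_le_abs_sub τ' (tauPt p)
        rw [abs_sub_comm] at this
        linarith
      have hpos : 0 < |tauPt p - τ'| := by linarith
      have hne : T * (tauPt p - τ') ≠ 0 := mul_ne_zero hT0.ne' (abs_pos.mp hpos)
      refine (hK₄d _ hne).trans ?_
      rw [abs_mul, abs_of_pos hT0, mul_pow]
      have hτ2 : 1 ≤ τ' ^ 2 := by rw [← sq_abs]; nlinarith
      have hτ0 : 0 < τ' ^ 2 := by linarith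
      rw [div_le_iff₀ (by positivity)]
      have h4 : (|τ'| / 2) ^ 4 ≤ |tauPt p - τ'| ^ 4 := pow_le_pow_left₀ (by positivity) hdist 4
      have e : 16 * K₄ / T ^ 4 * (1 / τ' ^ 2) * (T ^ 4 * |tauPt p - τ'| ^ 4) =
          16 * K₄ * (|tauPt p - τ'| ^ 4 / τ' ^ 2) := by field_simp
      rw [e]
      have h5 : τ' ^ 2 / 16 ≤ |tauPt p - τ'| ^ 4 / τ' ^ 2 := by
        rw [div_le_div_iff₀ (by norm_num) hτ0]
        have : (|τ'| / 2) ^ 4 = (τ' ^ 2) ^ 2 / 16 := by rw [div_pow, ← sq_abs τ']; ring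
        nlinarith [h4, this]
      nlinarith [h5, hτ2]
    calc ∑ p ∈ P, ‖F (T * (tauPt p - τ'))‖ ≤ ∑ p ∈ P, 16 * K₄ / T ^ 4 * (1 / τ' ^ 2) :=
          Finset.sum_le_sum hbound
      _ = (P.card : ℝ) * (16 * K₄ / T ^ 4 * (1 / τ' ^ 2)) := by rw [Finset.sum_const, nsmul_eq_mul]
      _ ≤ ((N : ℝ) + 1) ^ 2 * (16 * K₄ / T ^ 4 * (1 / τ' ^ 2)) :=
          mul_le_mul_of_nonneg_right (card_gcdPairs_le N d) (by positivity)
      _ = _ := by ring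
  -- Step 4: integrate the pointwise bound
  set B₁ : ℝ := 8 * K * (1 + 1 / (T * δ)) with hB₁
  set B₂ : ℝ := ((N : ℝ) + 1) ^ 2 * (16 * K₄ / T ^ 4) * (W.card : ℝ) ^ 3 with hB₂
  have hB₁0 : 0 ≤ B₁ := by positivity
  have hB₂0 : 0 ≤ B₂ := by positivity
  have hpt : ∀ τ' : ℝ, (∑ p ∈ P, ‖F (T * (tauPt p - τ'))‖) * ‖trigPoly W τ'‖ ^ 3 ≤
      B₁ * (Set.Icc (-1 : ℝ) 1).indicator (fun τ ↦ ‖trigPoly W τ‖ ^ 3) τ' +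
        B₂ * (if |τ'| ≤ 1 then (0 : ℝ) else 1 / τ' ^ 2) := by
    intro τ'
    have hS0 : 0 ≤ ∑ p ∈ P, ‖F (T * (tauPt p - τ'))‖ := Finset.sum_nonneg fun _ _ ↦ norm_nonneg _
    have hg0 : 0 ≤ ‖trigPoly W τ'‖ ^ 3 := by positivity
    by_cases hτ : |τ'| ≤ 1
    · rw [if_pos hτ, Set.indicator_of_mem (by rw [Set.mem_Icc]; exact abs_le.mp hτ), mul_zero, add_zero]
      exact mul_le_mul_of_nonneg_right (hS1 τ') hg0
    · rw [if_neg hτ, Set.indicator_of_notMem (by rw [Set.mem_Icc]; exact fun h ↦ hτ (abs_le.mpr h)),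
        mul_zero, zero_add]
      push Not at hτ
      have h3 : ‖trigPoly W τ'‖ ^ 3 ≤ (W.card : ℝ) ^ 3 := pow_le_pow_left₀ (norm_nonneg _) (hWle _) 3
      calc (∑ p ∈ P, ‖F (T * (tauPt p - τ'))‖) * ‖trigPoly W τ'‖ ^ 3
          ≤ (((N : ℝ) + 1) ^ 2 * (16 * K₄ / T ^ 4) * (1 / τ' ^ 2)) * (W.card : ℝ) ^ 3 :=
            mul_le_mul (hS2 τ' hτ) h3 hg0 (by positivity)
        _ = B₂ * (1 / τ' ^ 2) := by rw [hB₂]; ring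
  have hIind : Integrable (fun τ' ↦ (Set.Icc (-1 : ℝ) 1).indicator (fun τ ↦ ‖trigPoly W τ‖ ^ 3) τ') :=
    ((hWcont.norm.pow 3).integrableOn_Icc).integrable_indicator measurableSet_Icc
  have hIsum : Integrable (fun τ' ↦ (∑ p ∈ P, ‖F (T * (tauPt p - τ'))‖) * ‖trigPoly W τ'‖ ^ 3) := by
    have := integrable_finsetSum P (fun p _ ↦ hIp p)
    refine this.congr (Eventually.of_forall fun τ' ↦ ?_)
    simp only [Finset.sum_mul]
  have hstep4 : ∫ τ', (∑ p ∈ P, ‖F (T * (tauPt p - τ'))‖) * ‖trigPoly W τ'‖ ^ 3 ≤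
      B₁ * (∫ τ in Set.Icc (-1 : ℝ) 1, ‖trigPoly W τ‖ ^ 3) + B₂ * 2 := by
    have h1 := integral_mono hIsum ((hIind.const_mul B₁).add (hmi.const_mul B₂)) hpt
    refine h1.trans ?_
    simp only [Pi.add_apply]
    rw [integral_add (hIind.const_mul B₁) (hmi.const_mul B₂), integral_const_mul, integral_const_mul,
      integral_indicator measurableSet_Icc]
    gcongr
  -- Step 5: constants
  have hmain := hstep2.trans (mul_le_mul_of_nonneg_left hstep4 (by positivity))
  refine hmain.trans ?_
  have hI0 : 0 ≤ ∫ τ in Set.Icc (-1 : ℝ) 1, ‖trigPoly W τ‖ ^ 3 :=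
    setIntegral_nonneg measurableSet_Icc fun τ _ ↦ by positivity
  have hTδ : 1 / (T * δ) = 16 * π * (N : ℝ) ^ 2 / (T * (d : ℝ) ^ 2) := by
    rw [hδ]; field_simp
  have h1 : 2 * A ^ 2 * T * (B₁ * ∫ τ in Set.Icc (-1 : ℝ) 1, ‖trigPoly W τ‖ ^ 3) ≤
      C * (T + (N : ℝ) ^ 2 / (d : ℝ) ^ 2) * (∫ τ in Set.Icc (-1 : ℝ) 1, ‖trigPoly W τ‖ ^ 3) := by
    have e : 2 * A ^ 2 * T * (B₁ * ∫ τ in Set.Icc (-1 : ℝ) 1, ‖trigPoly W τ‖ ^ 3) =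
        (16 * A ^ 2 * K * (T + 16 * π * (N : ℝ) ^ 2 / (d : ℝ) ^ 2)) *
          (∫ τ in Set.Icc (-1 : ℝ) 1, ‖trigPoly W τ‖ ^ 3) := by
      rw [hB₁, hTδ]; field_simp; ring
    rw [e]
    refine mul_le_mul_of_nonneg_right ?_ hI0
    have hCge : 16 * A ^ 2 * K * (16 * π) ≤ C := le_max_left _ _
    have hπ1 : (1 : ℝ) ≤ 16 * π := by nlinarith [Real.two_le_pi]
    calc 16 * A ^ 2 * K * (T + 16 * π * (N : ℝ) ^ 2 / (d : ℝ) ^ 2)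
        ≤ 16 * A ^ 2 * K * (16 * π * (T + (N : ℝ) ^ 2 / (d : ℝ) ^ 2)) := by
          refine mul_le_mul_of_nonneg_left ?_ (by positivity)
          rw [mul_add, mul_div_assoc]
          gcongr
          nlinarith
      _ = 16 * A ^ 2 * K * (16 * π) * (T + (N : ℝ) ^ 2 / (d : ℝ) ^ 2) := by ring
      _ ≤ C * (T + (N : ℝ) ^ 2 / (d : ℝ) ^ 2) := mul_le_mul_of_nonneg_right hCge (by positivity)
  have h2 : 2 * A ^ 2 * T * (B₂ * 2) ≤ C * (N : ℝ) ^ 2 * (W.card : ℝ) ^ 3 / T ^ 3 := by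
    have hCge : 256 * A ^ 2 * K₄ ≤ C := le_max_right _ _
    have hN1 : ((N : ℝ) + 1) ^ 2 ≤ 4 * (N : ℝ) ^ 2 := by
      have : (1 : ℝ) ≤ N := by exact_mod_cast hN
      nlinarith
    have e : 2 * A ^ 2 * T * (B₂ * 2) = 64 * A ^ 2 * K₄ * ((N : ℝ) + 1) ^ 2 * (W.card : ℝ) ^ 3 / T ^ 3 := by
      rw [hB₂]; field_simp; ring
    rw [e, div_le_div_iff_of_pos_right (by positivity)]
    calc 64 * A ^ 2 * K₄ * ((N : ℝ) + 1) ^ 2 * (W.card : ℝ) ^ 3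
        ≤ 64 * A ^ 2 * K₄ * (4 * (N : ℝ) ^ 2) * (W.card : ℝ) ^ 3 := by gcongr
      _ = 256 * A ^ 2 * K₄ * (N : ℝ) ^ 2 * (W.card : ℝ) ^ 3 := by ring
      _ ≤ C * (N : ℝ) ^ 2 * (W.card : ℝ) ^ 3 := by gcongr
  calc 2 * A ^ 2 * T * (B₁ * (∫ τ in Set.Icc (-1 : ℝ) 1, ‖trigPoly W τ‖ ^ 3) + B₂ * 2)
      = 2 * A ^ 2 * T * (B₁ * ∫ τ in Set.Icc (-1 : ℝ) 1, ‖trigPoly W τ‖ ^ 3) +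
        2 * A ^ 2 * T * (B₂ * 2) := by ring
    _ ≤ _ := add_le_add h1 h2

end bump

/-! ## §3. Guth–Maynard Lemma 11.8 (Small GCD terms) -/

/-- **Cauchy–Schwarz on `[−1,1]`**: `∫_{[−1,1]} |Ŵ|³ ≤ (∫_{[−1,1]} |Ŵ|²)^{1/2} (∫_{[−1,1]} |Ŵ|⁴)^{1/2}`.
[folklore] -/
theorem setIntegral_cube_le (W : Finset ℝ) :
    ∫ τ in Set.Icc (-1 : ℝ) 1, ‖trigPoly W τ‖ ^ 3 ≤
      (∫ τ in Set.Icc (-1 : ℝ) 1, ‖trigPoly W τ‖ ^ 2) ^ (1 / 2 : ℝ) *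
        (∫ τ in Set.Icc (-1 : ℝ) 1, ‖trigPoly W τ‖ ^ 4) ^ (1 / 2 : ℝ) := by
  have hWcont : Continuous (trigPoly W) := by
    unfold trigPoly; refine continuous_finsetSum _ fun t _ ↦ ?_; fun_prop
  have hWle : ∀ τ' : ℝ, ‖trigPoly W τ'‖ ≤ W.card := norm_trigPoly_le W
  set μ := (volume : Measure ℝ).restrict (Set.Icc (-1 : ℝ) 1) with hμ
  have hf : MemLp (fun τ ↦ ‖trigPoly W τ‖) (ENNReal.ofReal 2) μ :=
    MemLp.of_bound hWcont.norm.aestronglyMeasurable (W.card : ℝ)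
      (Eventually.of_forall fun τ ↦ by rw [Real.norm_eq_abs, abs_norm]; exact hWle τ)
  have hg : MemLp (fun τ ↦ ‖trigPoly W τ‖ ^ 2) (ENNReal.ofReal 2) μ :=
    MemLp.of_bound (hWcont.norm.pow 2).aestronglyMeasurable ((W.card : ℝ) ^ 2)
      (Eventually.of_forall fun τ ↦ by
        rw [Real.norm_eq_abs, abs_of_nonneg (sq_nonneg _)]
        exact pow_le_pow_left₀ (norm_nonneg _) (hWle τ) 2)
  have h := integral_mul_le_Lp_mul_Lq_of_nonneg (μ := μ) Real.HolderConjugate.two_two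
    (Eventually.of_forall fun τ ↦ norm_nonneg (trigPoly W τ))
    (Eventually.of_forall fun τ ↦ sq_nonneg ‖trigPoly W τ‖) hf hg
  have e1 : ∀ τ : ℝ, ‖trigPoly W τ‖ * ‖trigPoly W τ‖ ^ 2 = ‖trigPoly W τ‖ ^ 3 := fun τ ↦ by ring
  have e2 : ∀ τ : ℝ, (‖trigPoly W τ‖) ^ (2 : ℝ) = ‖trigPoly W τ‖ ^ 2 := fun τ ↦ Real.rpow_two _
  have e3 : ∀ τ : ℝ, (‖trigPoly W τ‖ ^ 2) ^ (2 : ℝ) = ‖trigPoly W τ‖ ^ 4 := fun τ ↦ by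
    rw [Real.rpow_two]; ring
  simp only [e1, e2, e3] at h
  exact h

/-- A smooth compactly supported `Φ : ℝ → [0,1]` with `Φ = 1` on `[−1,1]` exists. [folklore] -/
theorem exists_symmBump : ∃ Φ : ℝ → ℝ, ContDiff ℝ ∞ Φ ∧ HasCompactSupport Φ ∧ (∀ x, 0 ≤ Φ x) ∧
    ∀ x : ℝ, |x| ≤ 1 → Φ x = 1 := by
  let f : ContDiffBump (0 : ℝ) := ⟨1, 2, by norm_num, by norm_num⟩
  refine ⟨f, f.contDiff, f.hasCompactSupport, fun x ↦ f.nonneg, fun x hx ↦ ?_⟩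
  apply f.one_of_mem_closedBall
  rw [Metric.mem_closedBall, Real.dist_eq, sub_zero]
  exact hx

/-- Domination of the `[−1,1]`-integral by the smoothed one: for `Φ ≥ 0` with `Φ = 1` on `[−1,1]`,
`Dl ≥ 1` and `k = 2, 4`: `∫_{[−1,1]} |Ŵ|^k ≤ |∫ Φ(τ/Dl) |Ŵ(τ)|^k dτ|`. [folklore] -/
theorem setIntegral_le_smoothed {Φ : ℝ → ℝ} (hΦ : ContDiff ℝ ∞ Φ) (hΦs : HasCompactSupport Φ)
    (hΦ0 : ∀ x, 0 ≤ Φ x) (hΦ1 : ∀ x : ℝ, |x| ≤ 1 → Φ x = 1) {Dl : ℝ} (hDl : 1 ≤ Dl) (W : Finset ℝ)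
    (k : ℕ) :
    ∫ τ in Set.Icc (-1 : ℝ) 1, ‖trigPoly W τ‖ ^ k ≤
      ‖∫ τ, ((Φ (τ / Dl) : ℝ) : ℂ) * (((‖trigPoly W τ‖ ^ k : ℝ)) : ℂ)‖ := by
  have hDl0 : 0 < Dl := by linarith
  have hWcont : Continuous (trigPoly W) := by
    unfold trigPoly; refine continuous_finsetSum _ fun t _ ↦ ?_; fun_prop
  have hWle : ∀ τ' : ℝ, ‖trigPoly W τ'‖ ≤ W.card := norm_trigPoly_le W
  -- the complex integral is the real one
  have hreal : ∫ τ, ((Φ (τ / Dl) : ℝ) : ℂ) * (((‖trigPoly W τ‖ ^ k : ℝ)) : ℂ) =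
      ((∫ τ, Φ (τ / Dl) * ‖trigPoly W τ‖ ^ k : ℝ) : ℂ) := by
    rw [← integral_complex_ofReal]
    refine integral_congr_ae (Eventually.of_forall fun τ ↦ ?_)
    push_cast; ring
  rw [hreal, Complex.norm_real, Real.norm_eq_abs]
  refine le_trans ?_ (le_abs_self _)
  -- integrability of the smoothed integrand
  have hΦi : Integrable (fun τ ↦ Φ (τ / Dl)) :=
    (hΦ.continuous.integrable_of_hasCompactSupport hΦs).comp_div hDl0.ne'
  have hI : Integrable (fun τ ↦ Φ (τ / Dl) * ‖trigPoly W τ‖ ^ k) :=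
    hΦi.mul_bdd (c := (W.card : ℝ) ^ k) ((hWcont.norm.pow k).aestronglyMeasurable)
      (Eventually.of_forall fun τ ↦ by
        rw [Real.norm_eq_abs, abs_of_nonneg (pow_nonneg (norm_nonneg _) k)]
        exact pow_le_pow_left₀ (norm_nonneg _) (hWle τ) k)
  rw [← integral_indicator measurableSet_Icc]
  refine integral_mono (((hWcont.norm.pow k).integrableOn_Icc).integrable_indicator
    measurableSet_Icc) hI fun τ ↦ ?_
  by_cases hτ : τ ∈ Set.Icc (-1 : ℝ) 1
  · rw [Set.indicator_of_mem hτ]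
    have : Φ (τ / Dl) = 1 := by
      apply hΦ1
      rw [abs_div, abs_of_pos hDl0, div_le_one hDl0]
      exact (abs_le.mpr (Set.mem_Icc.mp hτ)).trans hDl
    rw [this, one_mul]
  · rw [Set.indicator_of_notMem hτ]
    exact mul_nonneg (hΦ0 _) (by positivity)

/-- `∑_{d=1}^{D} (T + N²/d²) ≤ DT + 2N²`. [folklore] -/
theorem sum_weights_le (N D : ℕ) (T : ℝ) :
    ∑ d ∈ Finset.Icc 1 D, (T + (N : ℝ) ^ 2 / (d : ℝ) ^ 2) ≤ D * T + 2 * (N : ℝ) ^ 2 := by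
  rw [Finset.sum_add_distrib, Finset.sum_const, Nat.card_Icc, show D + 1 - 1 = D by omega,
    nsmul_eq_mul]
  have h1 : ∑ d ∈ Finset.Icc 1 D, (N : ℝ) ^ 2 / (d : ℝ) ^ 2 =
      (N : ℝ) ^ 2 * ∑ d ∈ Finset.Ioo 0 (D + 1), ((d : ℝ) ^ 2)⁻¹ := by
    rw [show Finset.Icc 1 D = Finset.Ioo 0 (D + 1) from rfl, Finset.mul_sum]
    refine Finset.sum_congr rfl fun d _ ↦ by rw [div_eq_mul_inv]
  rw [h1]
  have h2 := sum_Ioo_inv_sq_le (α := ℝ) 0 (D + 1)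
  norm_num at h2
  nlinarith [sq_nonneg (N : ℝ)]

set_option maxHeartbeats 1000000 in
/-- **Guth–Maynard Lemma 11.8 (Small GCD terms).** For every `j` there is `C` such that for all
`N, D ≥ 1`, `T ≥ 1`, `T₀`, `Dl ≥ 1` and finite `1`-separated `W ⊂ [T₀, T₀ + T]`,
`∑_{d ≤ D} ∑_{(n₁,n₂)∈[N,2N]², gcd = d} |R(n₁/n₂)|³ ≤ C (DT + N²) |W|^{1/2} (Dl·E(W) + Dl^{1−j}|W|⁴)^{1/2} + C D N²|W|³/T³`,
where `E(W)` is the additive energy count (the expression of `GuthMaynardAssembly.addEnergy`). In the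
paper `Dl = T^η` (so `Dl^{1−j}|W|⁴` is negligible) and `D = N²/T`, giving (11.23):
`∑_{gcd ≤ D}|R(n₁/n₂)|³ ⪅ N²|W|^{1/2}E(W)^{1/2}`. Proof: `gcdPairs_third_moment_le` summed over
`d` (`∑_d (T + N²/d²) ≤ DT + 2N²`), Cauchy–Schwarz on `[−1,1]`, and the `L²`/`L⁴` bounds
`SeparatedSums.L2_bound_sharp`, `GuthMaynardRFunction.L4_bound` for a bump `Φ = 1` on `[−1,1]`.
[cite: GuthMaynard2026, Lemma 11.8 and (11.23)] -/
theorem small_gcd_third_moment (j : ℕ) :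
    ∃ C, 0 ≤ C ∧ ∀ (N D : ℕ), 1 ≤ N → 1 ≤ D → ∀ (T T₀ Dl : ℝ), 1 ≤ T → 1 ≤ Dl →
      ∀ (W : Finset ℝ), (∀ t ∈ W, T₀ ≤ t ∧ t ≤ T₀ + T) →
      (∀ t ∈ W, ∀ t' ∈ W, t ≠ t' → 1 ≤ |t - t'|) →
      ∑ d ∈ Finset.Icc 1 D, ∑ p ∈ gcdPairs N d, ‖Rfun W ((p.1 : ℝ) / p.2)‖ ^ 3 ≤
        C * ((D : ℝ) * T + (N : ℝ) ^ 2) * (W.card : ℝ) ^ (1 / 2 : ℝ) *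
          (Dl * ((((W ×ˢ W) ×ˢ (W ×ˢ W)).filter
              (fun q : (ℝ × ℝ) × (ℝ × ℝ) ↦ |q.1.1 + q.1.2 - q.2.1 - q.2.2| ≤ 1)).card : ℝ) +
            Dl / Dl ^ j * (W.card : ℝ) ^ 4) ^ (1 / 2 : ℝ) +
        C * D * (N : ℝ) ^ 2 * (W.card : ℝ) ^ 3 / T ^ 3 := by
  obtain ⟨ψ, hψ, hψs, hψ1⟩ := exists_unitBump
  obtain ⟨C₁, hC₁0, hC₁⟩ := gcdPairs_third_moment_le hψ hψs hψ1
  obtain ⟨Φ, hΦ, hΦs, hΦ0, hΦ1⟩ := exists_symmBump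
  have hΦc : ContDiff ℝ ∞ (fun y ↦ (Φ y : ℂ)) := Complex.ofRealCLM.contDiff.comp hΦ
  have hΦcs : HasCompactSupport (fun y ↦ (Φ y : ℂ)) := hΦs.comp_left Complex.ofReal_zero
  obtain ⟨C₂, hC₂0, hC₂⟩ := L2_bound_sharp hΦc hΦcs
  obtain ⟨C₄, hC₄0, hC₄⟩ := L4_bound hΦc hΦcs j
  refine ⟨max (2 * C₁ * (2 * C₂) ^ (1 / 2 : ℝ) * C₄ ^ (1 / 2 : ℝ)) C₁, le_max_of_le_right hC₁0,
    fun N D hN hD T T₀ Dl hT hDl W hW hsep ↦ ?_⟩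
  have hT0 : 0 < T := by linarith
  set E₁ : ℝ := ((((W ×ˢ W) ×ˢ (W ×ˢ W)).filter
    (fun q : (ℝ × ℝ) × (ℝ × ℝ) ↦ |q.1.1 + q.1.2 - q.2.1 - q.2.2| ≤ 1)).card : ℝ) with hE₁
  set I₃ : ℝ := ∫ τ in Set.Icc (-1 : ℝ) 1, ‖trigPoly W τ‖ ^ 3 with hI₃
  set I₂ : ℝ := ∫ τ in Set.Icc (-1 : ℝ) 1, ‖trigPoly W τ‖ ^ 2 with hI₂
  set I₄ : ℝ := ∫ τ in Set.Icc (-1 : ℝ) 1, ‖trigPoly W τ‖ ^ 4 with hI₄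
  have hI₂0 : 0 ≤ I₂ := setIntegral_nonneg measurableSet_Icc fun τ _ ↦ by positivity
  have hI₄0 : 0 ≤ I₄ := setIntegral_nonneg measurableSet_Icc fun τ _ ↦ by positivity
  have hI₃0 : 0 ≤ I₃ := setIntegral_nonneg measurableSet_Icc fun τ _ ↦ by positivity
  -- Step 1: sum the per-`d` bound
  have h1 : ∑ d ∈ Finset.Icc 1 D, ∑ p ∈ gcdPairs N d, ‖Rfun W ((p.1 : ℝ) / p.2)‖ ^ 3 ≤
      C₁ * ((D : ℝ) * T + 2 * (N : ℝ) ^ 2) * I₃ + C₁ * D * (N : ℝ) ^ 2 * (W.card : ℝ) ^ 3 / T ^ 3 := by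
    calc ∑ d ∈ Finset.Icc 1 D, ∑ p ∈ gcdPairs N d, ‖Rfun W ((p.1 : ℝ) / p.2)‖ ^ 3
        ≤ ∑ d ∈ Finset.Icc 1 D, (C₁ * (T + (N : ℝ) ^ 2 / (d : ℝ) ^ 2) * I₃ +
            C₁ * (N : ℝ) ^ 2 * (W.card : ℝ) ^ 3 / T ^ 3) :=
          Finset.sum_le_sum fun d hd ↦ hC₁ N d hN (Finset.mem_Icc.mp hd).1 T T₀ hT W hW
      _ = C₁ * I₃ * ∑ d ∈ Finset.Icc 1 D, (T + (N : ℝ) ^ 2 / (d : ℝ) ^ 2) +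
            (D : ℝ) * (C₁ * (N : ℝ) ^ 2 * (W.card : ℝ) ^ 3 / T ^ 3) := by
          rw [Finset.sum_add_distrib, Finset.sum_const, Nat.card_Icc, show D + 1 - 1 = D by omega,
            nsmul_eq_mul, Finset.mul_sum]
          congr 1
          refine Finset.sum_congr rfl fun d _ ↦ by ring
      _ ≤ C₁ * I₃ * ((D : ℝ) * T + 2 * (N : ℝ) ^ 2) +
            (D : ℝ) * (C₁ * (N : ℝ) ^ 2 * (W.card : ℝ) ^ 3 / T ^ 3) := by
          gcongr
          exact sum_weights_le N D T
      _ = _ := by ring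
  -- Step 2: Cauchy–Schwarz and the `L²`, `L⁴` bounds
  have h2 : I₂ ≤ 2 * C₂ * W.card := by
    have := setIntegral_le_smoothed hΦ hΦs hΦ0 hΦ1 le_rfl W 2
    simp only [div_one] at this
    refine this.trans ((hC₂ W 1 one_pos hsep).trans (le_of_eq ?_))
    ring
  have h4 : I₄ ≤ C₄ * Dl * E₁ + C₄ * Dl / Dl ^ j * (W.card : ℝ) ^ 4 := by
    have := setIntegral_le_smoothed hΦ hΦs hΦ0 hΦ1 hDl W 4
    exact this.trans (hC₄ W Dl hDl)
  have h3 : I₃ ≤ (2 * C₂ * W.card) ^ (1 / 2 : ℝ) *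
      (C₄ * Dl * E₁ + C₄ * Dl / Dl ^ j * (W.card : ℝ) ^ 4) ^ (1 / 2 : ℝ) := by
    refine (setIntegral_cube_le W).trans ?_
    exact mul_le_mul (Real.rpow_le_rpow hI₂0 h2 (by norm_num))
      (Real.rpow_le_rpow hI₄0 h4 (by norm_num)) (by positivity) (by positivity)
  -- Step 3: constants
  have h3' : I₃ ≤ (2 * C₂) ^ (1 / 2 : ℝ) * C₄ ^ (1 / 2 : ℝ) * ((W.card : ℝ) ^ (1 / 2 : ℝ) *
      (Dl * E₁ + Dl / Dl ^ j * (W.card : ℝ) ^ 4) ^ (1 / 2 : ℝ)) := by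
    refine h3.trans (le_of_eq ?_)
    rw [Real.mul_rpow (by positivity) (by positivity),
      show C₄ * Dl * E₁ + C₄ * Dl / Dl ^ j * (W.card : ℝ) ^ 4 =
        C₄ * (Dl * E₁ + Dl / Dl ^ j * (W.card : ℝ) ^ 4) by ring,
      Real.mul_rpow hC₄0 (by positivity)]
    ring
  set K₀ : ℝ := (2 * C₂) ^ (1 / 2 : ℝ) * C₄ ^ (1 / 2 : ℝ) with hK₀
  have hK₀0 : 0 ≤ K₀ := by positivity
  set Cm : ℝ := max (2 * C₁ * (2 * C₂) ^ (1 / 2 : ℝ) * C₄ ^ (1 / 2 : ℝ)) C₁ with hCm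
  have hCm1 : 2 * C₁ * K₀ ≤ Cm := by rw [hCm, hK₀, ← mul_assoc]; exact le_max_left _ _
  have hCm2 : C₁ ≤ Cm := le_max_right _ _
  set Q : ℝ := (W.card : ℝ) ^ (1 / 2 : ℝ) * (Dl * E₁ + Dl / Dl ^ j * (W.card : ℝ) ^ 4) ^ (1 / 2 : ℝ)
    with hQ
  have hQ0 : 0 ≤ Q := by positivity
  have hDT : (D : ℝ) * T + 2 * (N : ℝ) ^ 2 ≤ 2 * ((D : ℝ) * T + (N : ℝ) ^ 2) := by
    nlinarith [mul_nonneg (Nat.cast_nonneg D) hT0.le]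
  calc ∑ d ∈ Finset.Icc 1 D, ∑ p ∈ gcdPairs N d, ‖Rfun W ((p.1 : ℝ) / p.2)‖ ^ 3
      ≤ C₁ * ((D : ℝ) * T + 2 * (N : ℝ) ^ 2) * I₃ + C₁ * D * (N : ℝ) ^ 2 * (W.card : ℝ) ^ 3 / T ^ 3 := h1
    _ ≤ C₁ * (2 * ((D : ℝ) * T + (N : ℝ) ^ 2)) * (K₀ * Q) +
        Cm * D * (N : ℝ) ^ 2 * (W.card : ℝ) ^ 3 / T ^ 3 := by
        gcongr
    _ = (2 * C₁ * K₀) * ((D : ℝ) * T + (N : ℝ) ^ 2) * Q +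
        Cm * D * (N : ℝ) ^ 2 * (W.card : ℝ) ^ 3 / T ^ 3 := by ring
    _ ≤ Cm * ((D : ℝ) * T + (N : ℝ) ^ 2) * Q + Cm * D * (N : ℝ) ^ 2 * (W.card : ℝ) ^ 3 / T ^ 3 := by
        gcongr
    _ = _ := by rw [hQ]; ring

end GuthMaynardSmallGCD

end Literature.NumberTheory.LFunctions

end
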